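import Summits.ResolutionOfSingularities.ResolutionOfSingularities.Theorems.FrobeniusLadderFRationalResolutionSingBlowupCover
import Summits.ResolutionOfSingularities.ResolutionOfSingularities.Theorems.FrobeniusLadderFRationalResolutionModelLocal
import Literature.AlgebraicGeometry.Resolution.ComponentGluing
import Literature.AlgebraicGeometry.Resolution.RegularLocalRingsProofs
import HarnessLib

/-!
# Crux `FrobeniusLadder.FRationalResolution` (stmt-ResolutionOfSingularities-15317), line `redirect`,
# stub `stub_diagonalizableQuotientResolution` — **design C3 OFF A FINITE SET: honest local resolutions at finitely
# many closed singular points + sharp rank-two log regular charts at every other singular point ⇒ `X` has a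
# resolution** (the junction of lineage 2's rank-2 stratum layer `…SingBlowupCover` with the isolated-point lane:
# the local resolutions are consumed in the `hloc` currency of `…IsolatedGlue` / `…ResolutionLocal`)

`X` integral, locally of finite type and quasi-compact over ANY field `k`; `S` a finite set of CLOSED singular points.
Suppose
* (`hloc`) every `s ∈ S` has an open `V ∋ s` meeting the singular locus only in `s` and a proper `ρ : Y → V` with
  `Y` REGULAR which is an isomorphism over `V ∩ Reg X` with dense preimage (an honest local resolution at the
  isolated singular point `s` — verbatim the local datum of `…IsolatedGlue.hasResolution_of_finite_singularLocus_of_local`);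
* (`H`) every singular point NOT in `S` carries a sharp rank-two Kato-log-regular chart in normal form through an
  étale roof (verbatim the hypothesis of `…SingBlowupCover.hasResolution_of_rank_two_logRegular_charts_of_quasiCompact`).
Then `Scheme.HasResolution X`.

Proof. Glue the local resolutions over the open `U = X ∖ S` by `stub_model_of_local_models` (`…ModelLocal`) for the
Zariski-local property `P Z` = «every stalk of `Z` is a domain ∧ every singular point of `Z` carries a rank-two
chart with a roof INTO `Z`»: `P U` holds because roofs restrict to opens (`roof_restrict`), `P Y` because `Y` is
regular, and `P` glues along two-piece open covers because roofs compose with open immersions (`roof_comp`) and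
regularity / domain stalks are read through the stalk isomorphisms of open immersions. The glued model
`π : X' → X` is proper, an isomorphism over the dense open `U` with dense preimage — so birational and `X'` is
integral — and `X'` satisfies `P`; hence `…SingBlowupCover` resolves `X'` (over `k` through `π ≫ f`) and
`Scheme.HasResolution.of_isBirational` transports the resolution to `X`.

* `roof_comp`, `roof_restrict` — étale roofs into a chart ring compose with open immersions / restrict to opens;
* `mem_regularLocus_iff_of_isOpenImmersion'` — open immersions identify regular points;
* **`hasResolution_of_rank_two_charts_off_finset`** — the theorem above.

Honest label: assembly toward ONE leaf stub (no stub, crux or summit closed): it lets the isolated-point lane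
(local resolutions, e.g. `…IsolatedFixedPointResolution`, lineage 4) and the rank-2 stratum lane (lineage 2) be
applied on the SAME `X`; singular points of sharp rank `≥ 3` lying on positive-dimensional singular strata remain
untouched. No definitions, no named facts, no sorry. [cite: Kato1994, Def. (2.1), (7.3), (10.1), (10.3), (10.4)]
[cite: Liu2002, §8.3.4, (3.11)] [folklore; cite: StacksProject, Tag 01JA]
-/

noncomputable section

-- single-problem summit: the doubled namespace component is forced
set_option linter.dupNamespace false

open CategoryTheory CategoryTheory.Limits AlgebraicGeometry TopologicalSpace
open IsLocalRing Literature.AlgebraicGeometry.Resolution Literature.AlgebraicGeometry.Resolution.LogChart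
open Summit.ResolutionOfSingularities.ResolutionOfSingularities.Theorems.FRationalResolution

namespace Summit.ResolutionOfSingularities.ResolutionOfSingularities.Theorems.FRationalResolution.SingBlowupOffFinset

/-! ## Roofs, regular points and domain stalks along open immersions -/

section Roof

variable {A : Type} [CommRing A] {n : ℕ} (P : AddSubmonoid (Fin n → ℤ)) (φ : Multiplicative P →* A)
  (𝔭 : Ideal A)

/-- **Étale roofs compose with open immersions.** A roof `X ←ρ— Y —j↪ Spec A` through `x` (log regular below the
points of `Y`) gives the roof `Z ←ρ ≫ i— Y —j↪ Spec A` through `i x` for an open immersion `i : X → Z`. [folklore] -/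
theorem roof_comp {X Z : Scheme.{0}} (i : X ⟶ Z) [IsOpenImmersion i] (x : X)
    (h : ∃ (Y : Scheme.{0}) (ρ : Y ⟶ X) (_ : Etale ρ) (j : Y ⟶ Spec (.of A)) (_ : IsOpenImmersion j) (y : Y),
      ρ y = x ∧ (j y).asIdeal = 𝔭 ∧
      (∀ (y' : Y) (𝔮 : Ideal A) [𝔮.IsPrime], 𝔮 ≤ (j y').asIdeal → IsLogRegularAt P φ 𝔮)) :
    ∃ (Y : Scheme.{0}) (ρ : Y ⟶ Z) (_ : Etale ρ) (j : Y ⟶ Spec (.of A)) (_ : IsOpenImmersion j) (y : Y),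
      ρ y = i x ∧ (j y).asIdeal = 𝔭 ∧
      (∀ (y' : Y) (𝔮 : Ideal A) [𝔮.IsPrime], 𝔮 ≤ (j y').asIdeal → IsLogRegularAt P φ 𝔮) := by
  obtain ⟨Y, ρ, _, j, _, y, hρy, hjy, hreg⟩ := h
  exact ⟨Y, ρ ≫ i, inferInstance, j, inferInstance, y, by rw [Scheme.Hom.comp_apply, hρy], hjy, hreg⟩

/-- **Étale roofs restrict to opens.** A roof `X ←ρ— Y —j↪ Spec A` through `x ∈ U` gives the roof
`U ←ρ∣U— ρ⁻¹U —↪ Spec A` through `⟨x, _⟩`. [folklore] -/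
theorem roof_restrict {X : Scheme.{0}} (U : X.Opens) (x : X) (hx : x ∈ U)
    (h : ∃ (Y : Scheme.{0}) (ρ : Y ⟶ X) (_ : Etale ρ) (j : Y ⟶ Spec (.of A)) (_ : IsOpenImmersion j) (y : Y),
      ρ y = x ∧ (j y).asIdeal = 𝔭 ∧
      (∀ (y' : Y) (𝔮 : Ideal A) [𝔮.IsPrime], 𝔮 ≤ (j y').asIdeal → IsLogRegularAt P φ 𝔮)) :
    ∃ (Y : Scheme.{0}) (ρ : Y ⟶ (U : Scheme.{0})) (_ : Etale ρ) (j : Y ⟶ Spec (.of A))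
      (_ : IsOpenImmersion j) (y : Y),
      ρ y = ⟨x, hx⟩ ∧ (j y).asIdeal = 𝔭 ∧
      (∀ (y' : Y) (𝔮 : Ideal A) [𝔮.IsPrime], 𝔮 ≤ (j y').asIdeal → IsLogRegularAt P φ 𝔮) := by
  obtain ⟨Y, ρ, _, j, _, y, hρy, hjy, hreg⟩ := h
  have hy : y ∈ ρ ⁻¹ᵁ U := by
    show ρ y ∈ U
    rw [hρy]
    exact hx
  refine ⟨(ρ ⁻¹ᵁ U : Y.Opens), ρ ∣_ U, inferInstance, (ρ ⁻¹ᵁ U).ι ≫ j, inferInstance, ⟨y, hy⟩, ?_, ?_, ?_⟩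
  · apply Subtype.ext
    rw [morphismRestrict_base_coe]
    exact hρy
  · rw [Scheme.Hom.comp_apply, Scheme.Opens.ι_apply]
    exact hjy
  · intro y' 𝔮 _ hle
    rw [Scheme.Hom.comp_apply, Scheme.Opens.ι_apply] at hle
    exact hreg y'.1 𝔮 hle

end Roof

/-- **Open immersions identify regular points**: for an open immersion `i : W → Z`, `w` is a regular point of
`W` iff `i w` is a regular point of `Z` (the stalk map is an isomorphism). [folklore] -/
theorem mem_regularLocus_iff_of_isOpenImmersion' {W Z : Scheme.{0}} (i : W ⟶ Z) [IsOpenImmersion i] (w : W) :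
    w ∈ Scheme.regularLocus W ↔ i w ∈ Scheme.regularLocus Z := by
  let e : Z.presheaf.stalk (i w) ≃+* W.presheaf.stalk w := (asIso (i.stalkMap w)).commRingCatIsoToRingEquiv
  simp only [Scheme.mem_regularLocus]
  exact ⟨fun _ => IsRegularLocalRing.of_ringEquiv e.symm, fun _ => IsRegularLocalRing.of_ringEquiv e⟩

/-- Domain stalks are read through an open immersion. [folklore] -/
theorem isDomain_stalk_of_isOpenImmersion {W Z : Scheme.{0}} (i : W ⟶ Z) [IsOpenImmersion i] (w : W)
    (h : IsDomain (W.presheaf.stalk w)) : IsDomain (Z.presheaf.stalk (i w)) :=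
  MulEquiv.isDomain (W.presheaf.stalk w) (asIso (i.stalkMap w)).commRingCatIsoToRingEquiv.toMulEquiv

/-- Stalks of an open subscheme of an integral scheme are domains. [folklore] -/
theorem isDomain_stalk_opens {X : Scheme.{0}} [IsIntegral X] (U : X.Opens) (u : (U : Scheme.{0})) :
    IsDomain ((U : Scheme.{0}).presheaf.stalk u) :=
  MulEquiv.isDomain (X.presheaf.stalk (U.ι u)) (asIso (U.ι.stalkMap u)).commRingCatIsoToRingEquiv.toMulEquiv.symm

set_option maxHeartbeats 1600000 in
/-- **Design C3 off a finite set.** `X` integral, locally of finite type and quasi-compact over a field `k`; `S` a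
finite set of closed singular points each carrying an honest local resolution (proper, regular source, an
isomorphism over `V ∩ Reg X` with dense preimage, on an open `V` meeting the singular locus only in the point);
every other singular point carries a sharp rank-two log regular chart through an étale roof (the hypothesis of
`…SingBlowupCover.hasResolution_of_rank_two_logRegular_charts_of_quasiCompact`, verbatim). Then `X` has a
resolution of singularities. See the module docstring. [cite: Kato1994, Def. (2.1), (7.3), (10.1), (10.3), (10.4)]
[folklore; cite: StacksProject, Tag 01JA] -/
theorem hasResolution_of_rank_two_charts_off_finset {k : Type} [Field k] (X : Scheme.{0}) [IsIntegral X]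
    (f : X ⟶ Spec (.of k)) [LocallyOfFiniteType f] [QuasiCompact f] (S : Finset X)
    (hSc : ∀ s ∈ S, IsClosed ({s} : Set X)) (hS : ∀ s ∈ S, s ∉ Scheme.regularLocus X)
    (hloc : ∀ s ∈ S, ∃ (V : X.Opens), s ∈ V ∧
      (∀ t : X, t ∉ Scheme.regularLocus X → t ∈ V → t = s) ∧
      ∃ (Y : Scheme.{0}) (ρ : Y ⟶ V), IsProper ρ ∧ Scheme.IsRegular Y ∧
        IsIso (ρ ∣_ (V.ι ⁻¹ᵁ ⟨Scheme.regularLocus X, isOpen_regularLocus_of_locallyOfFiniteType_field f⟩)) ∧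
        Dense ((ρ ⁻¹ᵁ (V.ι ⁻¹ᵁ ⟨Scheme.regularLocus X,
          isOpen_regularLocus_of_locallyOfFiniteType_field f⟩) : Y.Opens) : Set Y))
    (H : ∀ x : X, x ∉ Scheme.regularLocus X → x ∉ S →
      ∃ (A : Type) (_ : CommRing A) (_ : IsNoetherianRing A) (P : AddSubmonoid (Fin 2 → ℤ))
          (φ : Multiplicative P →* A) (𝔭 : Ideal A) (_ : 𝔭.IsPrime) (u e : Fin 2 → ℤ) (a d : ℕ),
          a < d ∧ P.FG ∧
          (∀ (w : Fin 2 → ℤ) (k : ℕ), 0 < k → k • w ∈ P → w ∈ P) ∧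
          Submodule.span ℤ (P : Set (Fin 2 → ℤ)) = ⊤ ∧
          (∀ p : P, (p : Fin 2 → ℤ) ≠ 0 → φ (Multiplicative.ofAdd p) ∈ 𝔭) ∧
          (∀ w, w ∈ P ↔ ∃ g ∈ Submodule.span ℤ (faceMonoid P φ 𝔭 : Set (Fin 2 → ℤ)), ∃ m l : ℤ,
            0 ≤ l ∧ (a : ℤ) * l ≤ (d : ℤ) * m ∧ w = g + m • u + l • e) ∧
          (∀ g ∈ Submodule.span ℤ (faceMonoid P φ 𝔭 : Set (Fin 2 → ℤ)), ∀ m l : ℤ,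
            g + m • u + l • e = 0 → m = 0 ∧ l = 0) ∧
          (∀ w : Fin 2 → ℤ, ∃ g ∈ Submodule.span ℤ (faceMonoid P φ 𝔭 : Set (Fin 2 → ℤ)),
            ∃ m l : ℤ, w = g + m • u + l • e) ∧
          ∃ (Y : Scheme.{0}) (ρ : Y ⟶ X) (_ : Etale ρ) (j : Y ⟶ Spec (.of A)) (_ : IsOpenImmersion j) (y : Y),
            ρ y = x ∧ (j y).asIdeal = 𝔭 ∧
            (∀ (y' : Y) (𝔮 : Ideal A) [𝔮.IsPrime], 𝔮 ≤ (j y').asIdeal → IsLogRegularAt P φ 𝔮)) :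
    Scheme.HasResolution X := by
  classical
  -- the Zariski-local property: domain stalks and rank-two roofs at the singular points
  let Pk : Scheme.{0} → Prop := fun Z => (∀ z : Z, IsDomain (Z.presheaf.stalk z)) ∧
    ∀ z : Z, z ∉ Scheme.regularLocus Z →
      ∃ (A : Type) (_ : CommRing A) (_ : IsNoetherianRing A) (P : AddSubmonoid (Fin 2 → ℤ))
          (φ : Multiplicative P →* A) (𝔭 : Ideal A) (_ : 𝔭.IsPrime) (u e : Fin 2 → ℤ) (a d : ℕ),
          a < d ∧ P.FG ∧
          (∀ (w : Fin 2 → ℤ) (k : ℕ), 0 < k → k • w ∈ P → w ∈ P) ∧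
          Submodule.span ℤ (P : Set (Fin 2 → ℤ)) = ⊤ ∧
          (∀ p : P, (p : Fin 2 → ℤ) ≠ 0 → φ (Multiplicative.ofAdd p) ∈ 𝔭) ∧
          (∀ w, w ∈ P ↔ ∃ g ∈ Submodule.span ℤ (faceMonoid P φ 𝔭 : Set (Fin 2 → ℤ)), ∃ m l : ℤ,
            0 ≤ l ∧ (a : ℤ) * l ≤ (d : ℤ) * m ∧ w = g + m • u + l • e) ∧
          (∀ g ∈ Submodule.span ℤ (faceMonoid P φ 𝔭 : Set (Fin 2 → ℤ)), ∀ m l : ℤ,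
            g + m • u + l • e = 0 → m = 0 ∧ l = 0) ∧
          (∀ w : Fin 2 → ℤ, ∃ g ∈ Submodule.span ℤ (faceMonoid P φ 𝔭 : Set (Fin 2 → ℤ)),
            ∃ m l : ℤ, w = g + m • u + l • e) ∧
          ∃ (Y : Scheme.{0}) (ρ : Y ⟶ Z) (_ : Etale ρ) (j : Y ⟶ Spec (.of A)) (_ : IsOpenImmersion j) (y : Y),
            ρ y = z ∧ (j y).asIdeal = 𝔭 ∧
            (∀ (y' : Y) (𝔮 : Ideal A) [𝔮.IsPrime], 𝔮 ≤ (j y').asIdeal → IsLogRegularAt P φ 𝔮)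
  -- `Pk` glues along two-piece open covers
  have hPglue : ∀ (Z U Y : Scheme.{0}) (i : U ⟶ Z) (j : Y ⟶ Z) [IsOpenImmersion i]
      [IsOpenImmersion j], i.opensRange ⊔ j.opensRange = ⊤ → Pk U → Pk Y → Pk Z := by
    intro Z U Y i j _ _ hcov hU hY
    have hpt : ∀ z : Z, (∃ u : U, i u = z) ∨ (∃ y : Y, j y = z) := by
      intro z
      have hz : z ∈ i.opensRange ⊔ j.opensRange := by rw [hcov]; trivial
      rcases Opens.mem_sup.mp hz with h | h
      · exact Or.inl h
      · exact Or.inr h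
    refine ⟨fun z => ?_, fun z hz => ?_⟩
    · rcases hpt z with ⟨u, rfl⟩ | ⟨y, rfl⟩
      · exact isDomain_stalk_of_isOpenImmersion i u (hU.1 u)
      · exact isDomain_stalk_of_isOpenImmersion j y (hY.1 y)
    · rcases hpt z with ⟨u, rfl⟩ | ⟨y, rfl⟩
      · have hu : u ∉ Scheme.regularLocus U := fun h => hz ((mem_regularLocus_iff_of_isOpenImmersion' i u).mp h)
        obtain ⟨A, _, _, P, φ, 𝔭, _, u₀, e, a, d, had, hP, hsat, hspanP, hface, hQ, hind, hspan, hroof⟩ := hU.2 u hu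
        exact ⟨A, inferInstance, inferInstance, P, φ, 𝔭, inferInstance, u₀, e, a, d, had, hP, hsat, hspanP, hface,
          hQ, hind, hspan, roof_comp P φ 𝔭 i u hroof⟩
      · have hy : y ∉ Scheme.regularLocus Y := fun h => hz ((mem_regularLocus_iff_of_isOpenImmersion' j y).mp h)
        obtain ⟨A, _, _, P, φ, 𝔭, _, u₀, e, a, d, had, hP, hsat, hspanP, hface, hQ, hind, hspan, hroof⟩ := hY.2 y hy
        exact ⟨A, inferInstance, inferInstance, P, φ, 𝔭, inferInstance, u₀, e, a, d, had, hP, hsat, hspanP, hface,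
          hQ, hind, hspan, roof_comp P φ 𝔭 j y hroof⟩
  -- the open `U = X ∖ S`
  have hSclosed : IsClosed ((S : Set X)) := by
    have : (S : Set X) = ⋃ s ∈ S, ({s} : Set X) := by
      ext x
      simp
    rw [this]
    exact isClosed_biUnion_finset fun s hs => hSc s hs
  let U : X.Opens := ⟨(S : Set X)ᶜ, hSclosed.isOpen_compl⟩
  have hmemU : ∀ x : X, x ∈ U ↔ x ∉ S := fun x => by
    show x ∈ (S : Set X)ᶜ ↔ x ∉ S
    rw [Set.mem_compl_iff, Finset.mem_coe]
  have hcov : ∀ x : X, x ∈ U ∨ x ∈ S := fun x => by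
    by_cases hx : x ∈ S
    · exact Or.inr hx
    · exact Or.inl ((hmemU x).mpr hx)
  -- `Pk U`: domain stalks (open of an integral scheme) and restricted roofs
  have hPU : Pk (U : Scheme.{0}) := by
    refine ⟨fun u => isDomain_stalk_opens U u, fun u hu => ?_⟩
    · have hx : U.ι u ∉ Scheme.regularLocus X := fun h => hu ((mem_regularLocus_iff_of_isOpenImmersion' U.ι u).mpr h)
      have hxS : u.1 ∉ S := (hmemU u.1).mp u.2
      obtain ⟨A, _, _, P, φ, 𝔭, _, u₀, e, a, d, had, hP, hsat, hspanP, hface, hQ, hind, hspan, hroof⟩ :=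
        H (U.ι u) hx (by rw [Scheme.Opens.ι_apply]; exact hxS)
      refine ⟨A, inferInstance, inferInstance, P, φ, 𝔭, inferInstance, u₀, e, a, d, had, hP, hsat, hspanP, hface,
        hQ, hind, hspan, ?_⟩
      have h := roof_restrict P φ 𝔭 U (U.ι u) (by rw [Scheme.Opens.ι_apply]; exact u.2) hroof
      have hu' : (⟨U.ι u, by rw [Scheme.Opens.ι_apply]; exact u.2⟩ : (U : Scheme.{0})) = u := Subtype.ext rfl
      rw [hu'] at h
      exact h
  -- the local resolutions at the points of `S`, in the currency of `U = X ∖ S`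
  have hloc' : ∀ s ∈ S, ∃ (V : X.Opens), s ∈ V ∧ (∀ t ∈ S, t ∈ V → t = s) ∧
      ∃ (Y : Scheme.{0}) (ρ : Y ⟶ V), IsProper ρ ∧ Pk Y ∧
        IsIso (ρ ∣_ (V.ι ⁻¹ᵁ U)) ∧ Dense ((ρ ⁻¹ᵁ (V.ι ⁻¹ᵁ U) : Y.Opens) : Set Y) := by
    intro s hs
    obtain ⟨V, hsV, hVS, Y, ρ, hρ, hY, hiso, hd⟩ := hloc s hs
    -- `V ∩ Reg X = V ∩ U` as opens of `V`
    have hVU : V.ι ⁻¹ᵁ (⟨Scheme.regularLocus X, isOpen_regularLocus_of_locallyOfFiniteType_field f⟩ : X.Opens) =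
        V.ι ⁻¹ᵁ U := by
      ext v
      change V.ι v ∈ Scheme.regularLocus X ↔ V.ι v ∈ ((S : Set X)ᶜ : Set X)
      rw [Scheme.Opens.ι_apply, Set.mem_compl_iff, Finset.mem_coe]
      constructor
      · intro hv hvS
        exact hS _ hvS hv
      · intro hvS
        by_contra hv
        exact hvS (by rw [hVS v.1 hv v.2]; exact hs)
    refine ⟨V, hsV, fun t ht htV => hVS t (hS t ht) htV, Y, ρ, hρ, ⟨fun y => ?_, fun y hy => ?_⟩, ?_, ?_⟩
    · haveI := hY y
      exact isDomain_of_isRegularLocalRing _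
    · exact (hy ((Scheme.mem_regularLocus y).mpr (hY y))).elim
    · rw [← hVU]
      exact hiso
    · rw [← hVU]
      exact hd
  obtain ⟨X', π, hπ, hPX', hiso, hd⟩ := stub_model_of_local_models Pk hPglue X U hPU S hcov hloc'
  haveI := hπ
  -- `U` is dense: it contains the generic point, a regular point
  have hgen : genericPoint X ∈ Scheme.regularLocus X := by
    change IsRegularLocalRing X.functionField
    infer_instance
  have hUd : Dense (U : Set X) :=
    U.isOpen.dense ⟨genericPoint X, (hmemU _).mpr fun h => hS _ h hgen⟩
  have hbir : IsBirational π := ⟨U, hUd, hd, hiso⟩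
  -- `X'` is integral: domain stalks, and a dense open isomorphic to the irreducible `U`
  haveI : ∀ x : X', IsDomain (X'.presheaf.stalk x) := hPX'.1
  haveI : IsReduced X' := isReduced_of_isReduced_stalk X'
  haveI : IrreducibleSpace X' := ComponentGluing.IsBirational.irreducibleSpace hbir
  haveI : IsIntegral X' := isIntegral_of_irreducibleSpace_of_isReduced X'
  -- resolve `X'` by design C3 (`…SingBlowupCover`) over `k` through `π ≫ f`, and transport along `π`
  have hres : Scheme.HasResolution X' :=
    SingBlowupCover.hasResolution_of_rank_two_logRegular_charts_of_quasiCompact X' (π ≫ f)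
      fun x hx => hPX'.2 x hx
  exact Scheme.HasResolution.of_isBirational π hbir hres

end Summit.ResolutionOfSingularities.ResolutionOfSingularities.Theorems.FRationalResolution.SingBlowupOffFinset

end
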